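import Summits.PneNP.PneNP.Theorems.ExpanderLinearGeneratorsGridRoutingOverlay
import Summits.PneNP.PneNP.Theorems.ExpanderLinearGeneratorsGridRoutingClauses

/-!
# PneNP / ExpanderLinearGenerators — a refutation of the overlaid system yields one of the grid
routing system (setting the overlay edges to `0`)

Route `PneNP/ExpanderLinearGenerators`, support for crux stmt-PneNP-11443. Substituting `⊥` for
the edge variables of the overlay `G` (and every grid variable for itself) turns the XOR-CNF of
`overlaySystem k C G` into a weakening of the XOR-CNF of `gridSystem k`: every substituted clause
of the equation of a copy-`0` row is implied by the (at most `16`) clauses of the corresponding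
grid equation, on its `≤ 4` variables, and every substituted clause of another row is identically
true. GIRS's transfer lemma (`TextbookFrege.transfer_isDepthProofOf`, truth tables on `≤ 4`
variables) then moves a depth-`d` `textbookFrege` refutation of the overlaid system to a
depth-`(d + 16)` refutation of the grid system of polynomially related size.

* `killSubst`, `holds_overlay_killVals` (the overlaid equation of `(c, i)` under the killed
  assignment holds iff `c ≠ 0` or the grid equation of `i` holds), `msum_gridClauses_le`,
  `exists_grid_proof_of_overlay_proof`.

References: N. Galesi, D. Itsykson, A. Riazanov, A. Sofronova, APAL 174 (2023), Lemma 10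
(transfer along a substitution); E. Ben-Sasson, Comput. Complexity 11 (2002), §4.
-/

namespace Summit.PneNP.PneNP.Theorems.GridRouting

set_option linter.dupNamespace false -- `Summit.PneNP.PneNP.…`: summit = sub-problem (D-0017)

open Finset Literature.Computability.Complexity.PropForm
open Literature.Computability.Complexity (PropForm Clause CNF Literal eventually_pow_lt_two_rpow_rpow)
open Literature.Computability.MetaComplexity Literature.Computability.MetaComplexity.TextbookFrege
open Literature.Computability.MetaComplexity.KrajicekRamsey (litOf clauseOf ofCNF_eq_conjList)

variable {k C : ℕ} {G : SimpleGraph (Fin C × Fin (nRows k))} [DecidableRel G.Adj]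

/-- Evaluating through the killing substitution is evaluating the killed assignment. [folklore] -/
theorem eval_killSubst (τ : ℕ → Bool) (x : ℕ) : (killSubst k x).eval τ = killVals k τ x := by
  unfold killSubst killVals
  split_ifs <;> simp [PropForm.eval]

/-- The number of a grid variable of the overlaid system. [folklore] -/
theorem val_ovarEquiv_inl (j : Fin (nVars k)) : ((ovarEquiv k C G (Sum.inl j) : Fin _) : ℕ) = j := by
  simp [ovarEquiv]

/-- The number of an edge variable of the overlaid system. [folklore] -/
theorem val_ovarEquiv_inr (e : Fin G.edgeFinset.card) :
    ((ovarEquiv k C G (Sum.inr e) : Fin _) : ℕ) = nVars k + e := by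
  simp [ovarEquiv]

/-- **The overlaid equation under the killed assignment.** The equation of `(c, i)` holds for the
block values of `killVals k τ` iff `c ≠ 0` or the grid equation of `i` holds for the block values
of `τ`: the edge terms vanish. [folklore] -/
theorem holds_overlay_killVals (τ : ℕ → Bool) (v : Fin C × Fin (nRows k))
    (h : (v.1 : ℕ) = 0 → (gridSystem k v.2).Holds (blockVals 2 1 (nVars k) τ)) :
    (overlaySystem k C G (orowEquiv k C v)).Holds (blockVals 2 1 (OVars k C G) (killVals k τ)) := by
  unfold LinEqMod.Holds
  rw [← (ovarEquiv k C G).sum_comp, Fintype.sum_sum_type]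
  simp only [overlaySystem, Equiv.symm_apply_apply, ocoef]
  -- edge terms vanish
  have hedge : ∑ e : Fin G.edgeFinset.card,
      (if v ∈ edgeOf k C G e then (1 : ZMod 2) else 0) *
        blockVals 2 1 (OVars k C G) (killVals k τ) (ovarEquiv k C G (Sum.inr e)) = 0 := by
    refine Finset.sum_eq_zero fun e _ => ?_
    rw [blockVals_one, val_ovarEquiv_inr]
    simp [killVals]
  rw [hedge, add_zero]
  -- grid terms are the grid equation
  have hgrid : ∀ j : Fin (nVars k), blockVals 2 1 (OVars k C G) (killVals k τ)
      (ovarEquiv k C G (Sum.inl j)) = blockVals 2 1 (nVars k) τ j := by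
    intro j
    rw [blockVals_one, blockVals_one, val_ovarEquiv_inl]
    simp [killVals, j.2]
  simp only [hgrid, ocharge]
  by_cases hc : (v.1 : ℕ) = 0
  · simp only [hc, if_true]
    exact h hc
  · simp [hc]

/-- **Every clause of the overlaid XOR-CNF, killed, is true under any assignment satisfying the
grid equation of its row** (nothing being required for rows off copy `0`). [folklore] -/
theorem eval_subst_killSubst_of_holds {v : Fin C × Fin (nRows k)} {c : Clause ℕ}
    (hc : c ∈ equationCNF 1 (overlaySystem k C G (orowEquiv k C v))) (τ : ℕ → Bool)
    (h : (v.1 : ℕ) = 0 → (gridSystem k v.2).Holds (blockVals 2 1 (nVars k) τ)) :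
    ((clauseOf c).subst (killSubst k)).eval τ = true := by
  rw [eval_subst, eval_clauseOf]
  have hev : (fun x => (killSubst k x).eval τ) = killVals k τ := funext (eval_killSubst τ)
  rw [hev]
  have hall := eval_equationCNF 1 (overlaySystem k C G (orowEquiv k C v)) (killVals k τ)
  rw [decide_eq_true (holds_overlay_killVals τ v h), CNF.eval_eq_true_iff] at hall
  exact hall c hc

/-- The variables of a killed clause of row `v` are numbers of grid variables of the grid part of
`v` (none off copy `0`). [folklore] -/
theorem mem_vars_subst_killSubst {v : Fin C × Fin (nRows k)} {c : Clause ℕ}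
    (hc : c ∈ equationCNF 1 (overlaySystem k C G (orowEquiv k C v))) {x : ℕ}
    (hx : x ∈ ((clauseOf c).subst (killSubst k)).vars) :
    (v.1 : ℕ) = 0 ∧ x ∈ eqVars 1 (gridSystem k v.2) := by
  obtain ⟨y, hy, hxy⟩ := mem_vars_subst hx
  unfold killSubst at hxy
  split_ifs at hxy with hlt
  · simp only [PropForm.vars, Finset.mem_singleton] at hxy
    subst hxy
    obtain ⟨l, hl, rfl⟩ := exists_literal_of_mem_vars_clauseOf hy
    have hv : l.1 ∈ eqVars 1 (overlaySystem k C G (orowEquiv k C v)) :=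
      fst_mem_of_mem_canonicalCNF hc hl
    obtain ⟨z, hz, hlz⟩ := mem_eqVars.1 hv
    obtain ⟨j0, hj0, hl1⟩ := mem_encBlock.1 hlz
    have hl1' : l.1 = (z : ℕ) := by omega
    obtain ⟨w, rfl⟩ := (ovarEquiv k C G).surjective z
    rcases w with j | e
    · rw [mem_supp_overlay_inl] at hz
      refine ⟨hz.1, ?_⟩
      rw [hl1', val_ovarEquiv_inl]
      exact mem_eqVars.2 ⟨j, hz.2, mem_encBlock.2 ⟨0, one_pos, by simp⟩⟩
    · exfalso
      rw [hl1', val_ovarEquiv_inr] at hlt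
      omega
  · simp [PropForm.vars] at hxy

/-- The grid XOR-CNF has at most `16` clauses per equation, each on the `≤ 4` variables of the
equation. [folklore] -/
theorem length_equationCNF_grid_le (i : Fin (nRows k)) :
    (equationCNF 1 (gridSystem k i)).length ≤ 16 := by
  unfold equationCNF canonicalCNF
  rw [List.length_map]
  refine (List.length_filter_le _ _).trans ?_
  rw [List.length_sublists, length_eqVars, mul_one]
  calc 2 ^ (gridSystem k i).supp.card ≤ 2 ^ 4 :=
        Nat.pow_le_pow_right (by norm_num) (card_supp_gridSystem_le k i)
    _ = 16 := by norm_num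

/-- Size of the rendered grid XOR-CNF: `msum ≤ 224 · nRows k`. [folklore] -/
theorem msum_gridClauses_le :
    msum ((sumEncoding 1 (gridSystem k)).map clauseOf) ≤ 224 * nRows k := by
  have hcl : ∀ X ∈ (sumEncoding 1 (gridSystem k)).map clauseOf, X.size + 1 ≤ 14 := by
    intro X hX
    obtain ⟨c, hc, rfl⟩ := List.mem_map.1 hX
    simp only [sumEncoding, List.mem_flatMap, List.mem_finRange, true_and] at hc
    obtain ⟨i, hi⟩ := hc
    obtain ⟨r, rfl⟩ := (rowEquiv k).surjective i
    have := size_clauseOf_le_of_mem_equationCNF hi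
    omega
  refine (msum_le_length_mul hcl).trans ?_
  rw [List.length_map]
  have hlen : (sumEncoding 1 (gridSystem k)).length ≤ nRows k * 16 := by
    unfold sumEncoding
    rw [List.length_flatMap]
    refine (sum_le_length_mul (b := 16) fun x hx => ?_).trans (by simp)
    obtain ⟨i, -, rfl⟩ := List.mem_map.1 hx
    exact length_equationCNF_grid_le i
  nlinarith

/-- **A refutation of the overlaid system yields a refutation of the grid system.** From a
depth-`d` `textbookFrege`-proof `π` of `¬ ofCNF (sumEncoding 1 (overlaySystem k C G))` one obtains a
depth-`(d + 16)` proof of `¬ ofCNF (sumEncoding 1 (gridSystem k))` of size at most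
`transferLines S (S + 224 nRows) 16 4 · (40 (19 (S + 224 nRows + 3) + 4) + 300)`, `S = proofSize π`.
[Galesi–Itsykson–Riazanov–Sofronova 2023, Lemma 10; Ben-Sasson 2002, §4] [folklore] -/
theorem exists_grid_proof_of_overlay_proof {d : ℕ} {π : List (PropForm ℕ)}
    (hπ : textbookFrege.IsDepthProofOf d π
      (neg (PropForm.ofCNF (sumEncoding 1 (overlaySystem k C G))))) :
    ∃ π', textbookFrege.IsDepthProofOf (d + 16) π'
        (neg (PropForm.ofCNF (sumEncoding 1 (gridSystem k)))) ∧
      proofSize π' ≤ transferLines (proofSize π) (proofSize π + 224 * nRows k) 16 4 *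
        (40 * ((16 + 3) * (proofSize π + 224 * nRows k + 3) + 4) + 300) := by
  set T := sumEncoding 1 (overlaySystem k C G)
  set T' := sumEncoding 1 (gridSystem k)
  have htr := transfer_isDepthProofOf T T' (killSubst k) (Zσ := 1) (Tσ := 0) (qq := 16) (k := 4)
    (fun x => by unfold killSubst; split_ifs <;> simp [size]) le_rfl
    (fun x c => by unfold killSubst; split_ifs <;> simp [altDepthAux]) hπ ?_
  · obtain ⟨π', hπ', hsize⟩ := htr
    refine ⟨π', by simpa using hπ', hsize.trans ?_⟩
    have hm := msum_gridClauses_le (k := k)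
    rw [Nat.mul_one]
    have h1 : transferLines (proofSize π) (proofSize π + msum (T'.map clauseOf)) 16 4 ≤
        transferLines (proofSize π) (proofSize π + 224 * nRows k) 16 4 := by
      unfold transferLines transferClauseLines tautLines
      gcongr
    exact Nat.mul_le_mul h1 (by nlinarith)
  -- the local implications
  intro c hc
  simp only [T, sumEncoding, List.mem_flatMap, List.mem_finRange, true_and] at hc
  obtain ⟨i, hi⟩ := hc
  obtain ⟨v, rfl⟩ := (orowEquiv k C).surjective i
  by_cases hv : (v.1 : ℕ) = 0
  · -- a row on copy `0`: all clauses of its grid equation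
    refine ⟨equationCNF 1 (gridSystem k v.2), eqVars 1 (gridSystem k v.2), ?_, ?_,
      nodup_eqVars 1 _, ?_, ?_, ?_, ?_⟩
    · intro K hK
      simp only [T', sumEncoding, List.mem_flatMap, List.mem_finRange, true_and]
      exact ⟨v.2, hK⟩
    · exact length_equationCNF_grid_le v.2
    · rw [length_eqVars, mul_one]
      exact card_supp_gridSystem_le k v.2
    · intro x hx
      exact (mem_vars_subst_killSubst hi hx).2
    · intro K hK x hx
      obtain ⟨l, hl, rfl⟩ := exists_literal_of_mem_vars_clauseOf hx
      exact fst_mem_of_mem_canonicalCNF hK hl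
    · intro τ hτ
      refine eval_subst_killSubst_of_holds hi τ fun _ => ?_
      have hall := eval_equationCNF 1 (gridSystem k v.2) τ
      have hev : (equationCNF 1 (gridSystem k v.2)).eval τ = true := by
        rw [CNF.eval_eq_true_iff]
        intro K hK
        have := hτ K hK
        rwa [eval_clauseOf] at this
      rw [hev] at hall
      exact of_decide_eq_true hall.symm
  · -- another copy: nothing is needed
    refine ⟨[], [], by simp, by simp, List.nodup_nil, by simp, ?_, by simp, ?_⟩
    · intro x hx
      exact absurd (mem_vars_subst_killSubst hi hx).1 hv
    · intro τ _
      exact eval_subst_killSubst_of_holds hi τ fun h0 => absurd h0 hv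

end Summit.PneNP.PneNP.Theorems.GridRouting
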